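import Summits.QuantumFields.GaugeBoot.TiltedFrameNoGo
import HarnessLib

/-!
# Rigidity of the Osterwalder–Seiler frames on a periodic lattice: intrinsic half periods, unique
# mirrors and heights, and no tilted frames in two coordinate planes sharing an axis
# (gauge-boot, L3 structural supplement)

HONEST FRAMING (cell `pub-gaugeboot`, page 1 of every file): the venture produces certified bounds
on lattice expectations at stated coupling, gauge group, dimension and torus size; NOT a mass gap,
NOT a continuum limit, NOT a string tension; NOT Yang–Mills-summit-bearing (barriers
`FixedCouplingUltralocality`, `PerturbativeInvisibility`). This module is a small STRUCTURAL result
about the lane's two reflection mechanisms (`IsTiltedFrame`, `TiltedRPGeometry.lean`;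
`IsSiteFrame`, `TiltedSiteRPGeometry.lean`); it bounds no expectation and discharges nothing else.

Continuation of `TiltedFrameNoGo.lean` (a tilted diagonal frame for `(i, j)` excludes a site frame
along `i` and along `j`). On a periodic lattice `(A, e)` — any additive commutative group `A`, any
marked translations `e : Fin d → A`, no finiteness — we record:

* `IsTiltedFrame.symm`: a tilted frame for `(i, j)` with height `v` is a tilted frame for `(j, i)`
  with height `-v` (same mirror, same half period, same two layers).
* **Intrinsic half periods.** A tilted frame for `(i, j)` forces `addOrderOf (e_i - e_j) = P`
  (`IsTiltedFrame.addOrderOf_e_sub_e`; the site analogue `addOrderOf (e_k) = 2Q` is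
  `IsSiteFrame.addOrderOf_e_self` of `TiltedFrameNoGo.lean`). Hence the half period of a frame is
  determined by the lattice and the plane / axis (`IsTiltedFrame.halfPeriod_unique`, `_unique_symm`;
  `IsSiteFrame.halfPeriod_unique`): there is no freedom in `P`, `Q`.
* **Unique mirrors and heights.** If the marked translations generate `A`
  (`AddSubgroup.closure (range e) = ⊤` — every periodic box `ℤ^d / Γ` with `e_m = [unit vector]`)
  then the mirror and the height of a frame are unique (`IsTiltedFrame.mirror_unique`,
  `height_unique`; `IsSiteFrame.mirror_unique`, `height_unique`): the frame, when it exists, IS the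
  Fröhlich–Israel–Lieb–Simon swap `x_i ↔ x_j` with `v = x_i - x_j`, resp. the reflection
  `x_k ↦ -x_k` with `h = x_k`.
* **THE SECOND NO-GO (`IsTiltedFrame.not_isTiltedFrame_adjacent` and its symmetric forms
  `not_isTiltedFrame_shareLeft/shareRight`).** Tilted diagonal frames in two coordinate planes
  `(i, j)` and `(i', j')` sharing EXACTLY ONE axis cannot coexist, for any mirrors, half periods and
  heights. Proof (the arithmetic of `TiltedFrameNoGo.lean`): the `(i, j)` frame forces
  `P • e_i = P • e_j`; applying the height `v'` of a `(j, l)` frame (`v' (e_j) = 1`, `v' (e_i) = 0`)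
  gives `2P' ∣ P`; symmetrically `2P ∣ P'`; impossible for `P, P' ≥ 2`.

Together with `TiltedFrameNoGo.lean` this gives the COMPATIBILITY RULE for the lane's sufficient
structures on one periodic volume: the coordinate planes carrying tilted diagonal frames are pairwise
disjoint (a matching of the axes) and disjoint from the axes carrying site frames; per plane / axis
the frame data are unique. (`PeriodicBoxSiteFrames.lean` / `PeriodicBoxTiltedFrames.lean`
classify the boxes `ℤ^d / Γ` carrying each frame; `DoublyTiltedBox.lean` shows the rule is sharp:
two DISJOINT planes do coexist on a doubly tilted box, `d ≥ 4`.)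
For the bootstrap (Kazakov–Zheng arXiv:2203.11360 §3.1: three reflection-positivity families, used
in all coordinate directions and planes at once on `ℤ^4`): no single finite periodic volume offers the
Osterwalder–Seiler mechanism for the diagonal family in two planes through a common axis, e.g.
`(0, 1)` and `(1, 2)`; at most `⌊d/2⌋` diagonal planes per volume.

What this module does NOT say: it is about FRAMES (sufficient structures), not about reflection
positivity itself; RP-level failures are the lane's negative theorems (`DiagonalRPTorusNegative.lean`
ff., `TiltedBoxAxisRPNegative.lean`, `TiltedBoxRedSiteRPNegativeUniform.lean`).

References: J. Fröhlich, R. Israel, E. H. Lieb, B. Simon, Comm. Math. Phys. 62 (1978) 1, Thm. 2.1,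
and J. Stat. Phys. 22 (1980) 297, §3; K. Osterwalder, E. Seiler, Ann. Phys. 110 (1978) 440, §2;
S. Friedli, Y. Velenik, Statistical Mechanics of Lattice Systems (2017) §10.3 (reflections of the
torus through vertices / edges); V. Kazakov, Z. Zheng, arXiv:2203.11360 §3.1.
-/

namespace Summit.QuantumFields.GaugeBoot

namespace TiltedRP

variable {A : Type*} [AddCommGroup A] {d : ℕ}

/-! ## Site frames: the half period is intrinsic; mirror and height are unique under generation -/

namespace IsSiteFrame

variable {e : Fin d → A} {k : Fin d} {σ : A →+ A} {Q : ℕ} {h : A →+ ZMod (2 * Q)}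
variable (hF : IsSiteFrame e k σ Q h)
include hF

/-- **The half period of a site frame along `k` is intrinsic**: two site frames along the same axis
have the same half period (`addOrderOf (e_k) = 2Q = 2Q'`). -/
theorem halfPeriod_unique {σ' : A →+ A} {Q' : ℕ} {h' : A →+ ZMod (2 * Q')}
    (hF' : IsSiteFrame e k σ' Q' h') : Q = Q' := by
  have h1 := hF.addOrderOf_e_self.symm.trans hF'.addOrderOf_e_self
  omega

/-- **The reflection of a site frame is unique** when the marked translations generate the site
group (it is `e_k ↦ -e_k`, `e_l ↦ e_l`). -/
theorem mirror_unique (hgen : AddSubgroup.closure (Set.range e) = ⊤) {σ' : A →+ A} {Q' : ℕ}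
    {h' : A →+ ZMod (2 * Q')} (hF' : IsSiteFrame e k σ' Q' h') : σ = σ' := by
  refine AddMonoidHom.eq_of_eqOn_dense hgen ?_
  rintro _ ⟨l, rfl⟩
  by_cases hl : l = k
  · subst hl
    rw [hF.map_e_self, hF'.map_e_self]
  · rw [hF.map_e_other l hl, hF'.map_e_other l hl]

/-- **The height of a site frame is unique** when the marked translations generate the site group
(it is `e_k ↦ 1`, `e_l ↦ 0`; same half period, cf. `halfPeriod_unique`). -/
theorem height_unique (hgen : AddSubgroup.closure (Set.range e) = ⊤) {σ' : A →+ A}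
    {h' : A →+ ZMod (2 * Q)} (hF' : IsSiteFrame e k σ' Q h') : h = h' := by
  refine AddMonoidHom.eq_of_eqOn_dense hgen ?_
  rintro _ ⟨l, rfl⟩
  by_cases hl : l = k
  · subst hl
    rw [hF.height_self, hF'.height_self]
  · rw [hF.height_other l hl, hF'.height_other l hl]

end IsSiteFrame

/-! ## Tilted frames: symmetry, intrinsic half period, uniqueness -/

namespace IsTiltedFrame

variable {e : Fin d → A} {i j : Fin d} {θ : A →+ A} {P : ℕ} {v : A →+ ZMod (2 * P)}
variable (hF : IsTiltedFrame e i j θ P v)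
include hF

/-- **Symmetry.** A tilted diagonal frame for `(i, j)` with height `v` is a tilted diagonal frame for
`(j, i)` with height `-v`: same mirror, same half period, and the same two layers
(`-v = 0 ↔ v = 0`, `-v = P ↔ v = P` in `ZMod (2P)`). -/
theorem symm : IsTiltedFrame e j i θ P (-v) where
  ne := hF.ne.symm
  two_le := hF.two_le
  map_e k := by rw [hF.map_e, Equiv.swap_comm]
  invol := hF.invol
  height_left := by rw [AddMonoidHom.neg_apply, hF.height_right, neg_neg]
  height_right := by rw [AddMonoidHom.neg_apply, hF.height_left]
  height_other k hkj hki := by rw [AddMonoidHom.neg_apply, hF.height_other k hki hkj, neg_zero]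
  height_map x := by rw [AddMonoidHom.neg_apply, AddMonoidHom.neg_apply, hF.height_map]
  fix_of_layer x hx := by
    apply hF.fix_of_layer x
    rwa [AddMonoidHom.neg_apply, neg_eq_zero, neg_eq_iff_eq_neg, neg_natCast_self] at hx

/-- The height of `n • (e_i - e_j)` is `2n (mod 2P)`. -/
theorem height_nsmul_e_sub_e (n : ℕ) : v (n • (e i - e j)) = ((2 * n : ℕ) : ZMod (2 * P)) := by
  rw [map_nsmul, map_sub, hF.height_left, hF.height_right, sub_neg_eq_add, nsmul_eq_mul,
    Nat.cast_mul, Nat.cast_two]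
  ring

/-- `n • (e_i - e_j) = 0` only if `P ∣ n` (apply the height: `2P ∣ 2n`). -/
theorem dvd_of_nsmul_e_sub_e {n : ℕ} (hn : n • (e i - e j) = 0) : P ∣ n := by
  have hh := hF.height_nsmul_e_sub_e n
  rw [hn, map_zero] at hh
  have h2 : 2 * P ∣ 2 * n := (ZMod.natCast_eq_zero_iff _ _).1 hh.symm
  exact Nat.dvd_of_mul_dvd_mul_left (by norm_num) h2

/-- **The diagonal half period is intrinsic**: `addOrderOf (e_i - e_j) = P` (the period
`P • (e_i - e_j) = 0` of `TiltedFrameNoGo.lean` is the exact order). On the tilted box this reads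
`M_v`; on the cubic torus `(ℤ/L)^d` the order is `L` but no frame exists. -/
theorem addOrderOf_e_sub_e : addOrderOf (e i - e j) = P :=
  Nat.dvd_antisymm (addOrderOf_dvd_of_nsmul_eq_zero hF.nsmul_e_sub_e_eq_zero)
    (hF.dvd_of_nsmul_e_sub_e (addOrderOf_nsmul_eq_zero (e i - e j)))

/-- Two tilted diagonal frames in the same coordinate plane `(i, j)` have the same half period. -/
theorem halfPeriod_unique {θ' : A →+ A} {P' : ℕ} {v' : A →+ ZMod (2 * P')}
    (hF' : IsTiltedFrame e i j θ' P' v') : P = P' :=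
  hF.addOrderOf_e_sub_e.symm.trans hF'.addOrderOf_e_sub_e

/-- The same for the reversed pair `(j, i)`. -/
theorem halfPeriod_unique_symm {θ' : A →+ A} {P' : ℕ} {v' : A →+ ZMod (2 * P')}
    (hF' : IsTiltedFrame e j i θ' P' v') : P = P' :=
  hF.halfPeriod_unique hF'.symm

/-- **The mirror of a tilted diagonal frame is unique** when the marked translations generate the
site group (it is the swap `e_k ↦ e_{(i j) k}`), whatever the half periods and heights. -/
theorem mirror_unique (hgen : AddSubgroup.closure (Set.range e) = ⊤) {θ' : A →+ A} {P' : ℕ}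
    {v' : A →+ ZMod (2 * P')} (hF' : IsTiltedFrame e i j θ' P' v') : θ = θ' := by
  refine AddMonoidHom.eq_of_eqOn_dense hgen ?_
  rintro _ ⟨k, rfl⟩
  rw [hF.map_e, hF'.map_e]

/-- The mirror is also that of any frame of the reversed pair `(j, i)`. -/
theorem mirror_unique_symm (hgen : AddSubgroup.closure (Set.range e) = ⊤) {θ' : A →+ A} {P' : ℕ}
    {v' : A →+ ZMod (2 * P')} (hF' : IsTiltedFrame e j i θ' P' v') : θ = θ' :=
  hF.mirror_unique hgen hF'.symm

/-- **The height of a tilted diagonal frame is unique** when the marked translations generate the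
site group (it is `e_i ↦ 1`, `e_j ↦ -1`, `e_k ↦ 0`; same half period, cf. `halfPeriod_unique`). -/
theorem height_unique (hgen : AddSubgroup.closure (Set.range e) = ⊤) {θ' : A →+ A}
    {v' : A →+ ZMod (2 * P)} (hF' : IsTiltedFrame e i j θ' P v') : v = v' := by
  refine AddMonoidHom.eq_of_eqOn_dense hgen ?_
  rintro _ ⟨k, rfl⟩
  by_cases hki : k = i
  · subst hki
    rw [hF.height_left, hF'.height_left]
  · by_cases hkj : k = j
    · subst hkj
      rw [hF.height_right, hF'.height_right]
    · rw [hF.height_other k hki hkj, hF'.height_other k hki hkj]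

/-- For the reversed pair the height is the opposite one. -/
theorem height_unique_symm (hgen : AddSubgroup.closure (Set.range e) = ⊤) {θ' : A →+ A}
    {v' : A →+ ZMod (2 * P)} (hF' : IsTiltedFrame e j i θ' P v') : v' = -v :=
  (hF.symm.height_unique hgen hF').symm

/-! ## The second no-go: no tilted frames in two coordinate planes sharing exactly one axis -/

/-- **No tilted diagonal frames in adjacent planes.** A periodic lattice with a tilted diagonal frame
for `(i, j)` carries no tilted diagonal frame for `(j, l)`, `l ≠ i` — for ANY mirror `θ'`, half
period `P'` and height `v'`. (Apply `v'` to `P • e_i = P • e_j`: `2P' ∣ P`; apply `v` to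
`P' • e_j = P' • e_l`: `2P ∣ P'`; impossible for `P, P' ≥ 2`.) -/
theorem not_isTiltedFrame_adjacent {l : Fin d} (hli : l ≠ i) {θ' : A →+ A} {P' : ℕ}
    {v' : A →+ ZMod (2 * P')} : ¬ IsTiltedFrame e j l θ' P' v' := by
  intro hF'
  have hP := hF.two_le
  have hP' := hF'.two_le
  -- `2P' ∣ P`: apply `v'` to `P • e_i = P • e_j`
  have h1 : 2 * P' ∣ P := by
    have hh := congrArg v' hF.nsmul_e_left_eq_nsmul_e_right
    rw [map_nsmul, map_nsmul, hF'.height_other i hF.ne hli.symm, hF'.height_left, smul_zero,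
      nsmul_eq_mul, mul_one] at hh
    exact (ZMod.natCast_eq_zero_iff _ _).1 hh.symm
  -- `2P ∣ P'`: apply `v` to `P' • e_j = P' • e_l`
  have h2 : 2 * P ∣ P' := by
    have hh := congrArg v hF'.nsmul_e_left_eq_nsmul_e_right
    rw [map_nsmul, map_nsmul, hF.height_right, hF.height_other l hli hF'.ne.symm, smul_neg,
      smul_zero, neg_eq_zero, nsmul_eq_mul, mul_one] at hh
    exact (ZMod.natCast_eq_zero_iff _ _).1 hh
  have h3 : 2 * P' ≤ P := Nat.le_of_dvd (by omega) h1
  have h4 : 2 * P ≤ P' := Nat.le_of_dvd (by omega) h2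
  omega

/-- **Planes sharing the FIRST axis of `(i', j')`.** No tilted diagonal frame for a pair `(i', j')`
whose first axis lies in the plane, `i' = i` or `i' = j`, and whose second axis does not,
`j' ∉ {i, j}`. -/
theorem not_isTiltedFrame_shareLeft {i' j' : Fin d} (hi' : i' = i ∨ i' = j) (hj'i : j' ≠ i)
    (hj'j : j' ≠ j) {θ' : A →+ A} {P' : ℕ} {v' : A →+ ZMod (2 * P')} :
    ¬ IsTiltedFrame e i' j' θ' P' v' := by
  rcases hi' with rfl | rfl
  · -- `(i, j')`: use the `(j, i)` form of `hF`
    exact hF.symm.not_isTiltedFrame_adjacent hj'j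
  · -- `(j, j')`
    exact hF.not_isTiltedFrame_adjacent hj'i

/-- **Planes sharing the axis which is SECOND in `(i', j')`.** No tilted diagonal frame for a pair
`(i', j')` with `j' = i` or `j' = j` and `i' ∉ {i, j}`. -/
theorem not_isTiltedFrame_shareRight {i' j' : Fin d} (hj' : j' = i ∨ j' = j) (hi'i : i' ≠ i)
    (hi'j : i' ≠ j) {θ' : A →+ A} {P' : ℕ} {v' : A →+ ZMod (2 * P')} :
    ¬ IsTiltedFrame e i' j' θ' P' v' := fun hF' =>
  hF.not_isTiltedFrame_shareLeft (i' := j') (j' := i') hj' hi'i hi'j hF'.symm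

/-- **THE SECOND NO-GO, both forms at once.** On every periodic lattice `(A, e)`: if the coordinate
planes `{i, j}` and `{i', j'}` share exactly one axis, tilted diagonal frames for `(i, j)` and for
`(i', j')` cannot coexist — whatever the mirrors, half periods and heights. With
`TiltedFrameNoGo.lean`: the planes carrying tilted diagonal frames on one periodic volume are
pairwise disjoint and avoid the axes carrying site frames. -/
theorem not_isTiltedFrame_of_share {i' j' : Fin d}
    (hshare : ((i' = i ∨ i' = j) ∧ j' ≠ i ∧ j' ≠ j) ∨ ((j' = i ∨ j' = j) ∧ i' ≠ i ∧ i' ≠ j))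
    {θ' : A →+ A} {P' : ℕ} {v' : A →+ ZMod (2 * P')} : ¬ IsTiltedFrame e i' j' θ' P' v' := by
  rcases hshare with ⟨h1, h2, h3⟩ | ⟨h1, h2, h3⟩
  · exact hF.not_isTiltedFrame_shareLeft h1 h2 h3
  · exact hF.not_isTiltedFrame_shareRight h1 h2 h3

/-- In particular a frame for `(i, j)` excludes a frame for `(i, l)` for every third axis
`l ∉ {i, j}` (e.g. the planes `(0, 1)` and `(0, 2)` of `ℤ^4 / Γ`) … -/
theorem not_isTiltedFrame_sameLeft {l : Fin d} (hli : l ≠ i) (hlj : l ≠ j) {θ' : A →+ A}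
    {P' : ℕ} {v' : A →+ ZMod (2 * P')} : ¬ IsTiltedFrame e i l θ' P' v' :=
  hF.not_isTiltedFrame_shareLeft (Or.inl rfl) hli hlj

/-- … and a frame for `(l, j)` for every third axis `l ∉ {i, j}`. -/
theorem not_isTiltedFrame_sameRight {l : Fin d} (hli : l ≠ i) (hlj : l ≠ j) {θ' : A →+ A}
    {P' : ℕ} {v' : A →+ ZMod (2 * P')} : ¬ IsTiltedFrame e l j θ' P' v' :=
  hF.not_isTiltedFrame_shareRight (Or.inr rfl) hli hlj

end IsTiltedFrame

end TiltedRP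

end Summit.QuantumFields.GaugeBoot
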